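import Mathlib
import HarnessLib
import Summits.ValiantsHypothesis.ValiantsHypothesis.Theorems.MonotoneRestorationOrbitRestorationQPInjectivePlacementsPoly
import Summits.ValiantsHypothesis.ValiantsHypothesis.Theorems.MonotoneRestorationOrbitRestorationQPStableLocalFactors

/-!
# Exactly permuted families of POLYNOMIAL local forms have narrow products (SPAN currency)

Route MonotoneRestoration, crux `OrbitRestorationQP` (stmt-ValiantsHypothesis-18293), SPAN-currency lane of the open
sub-rung A_∞ (`stub_sigmaPiSigmaValue`).  Helper (`--supports`), def-free.  Polynomial version of
`CorePatterns.prod_mem_narrowSpan_of_stable_localFactors` (`…StableLocalFactors.lean`, affine local forms):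

* **`prod_mem_narrowSpan_of_stable_localPolyFactors`** — a finite family `(Lf_i)` of PLACED POLYNOMIAL LOCAL FORMS
  (`Lf_i = P_i(x_{φ_i a, ψ_i b}, R_{φ_i a}, C_{ψ_i b})` for a polynomial `P_i` in the atoms of a core `Fin r_i × Fin c_i`
  with `r_i + c_i ≤ w`, placed injectively) that is EXACTLY permuted by every row/column renaming has
  `Π_i Lf_i ∈ span_ℂ {hom_{F,n} : tw F ≤ w}` — polynomial orbits.  Proof as in the affine case: Newton on the whole
  family (`NarrowSpanNewton.prod_mem_narrowSpan_of_psum_mem`), permutation averaging of the power sums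
  (`exists_sum_perm_comp_eq`), and INJ for the polynomial `P_i ^ m` (`sum_injective_injective_aeval_mem_narrowSpan`).

Lane note (twisted residue of the `ΠΣ` sub-rung): grouping the factors of a matrix-symmetric affine product by their
row/column supports gives placed polynomial local forms (products of the affine factors with a common support); when
no support-stabiliser acts on its group by a sign (the BLOCK-UNTWISTED case, which contains every eigen-free family and
e.g. the cube-root-twisted family `Π (x_{aq} + ω x_{a'q} + ω² x_{a''q})`), the groups can be rescaled to an exactly
permuted family and this theorem applies.  The bookkeeping from supports to this theorem's hypotheses is not in this
file.  No registered stub is closed; the crux and VP ≠ VNP are not moved. [folklore]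
-/

noncomputable section

-- `Summit.ValiantsHypothesis.ValiantsHypothesis.…` is the tree's single-conjunct layout (Sub = Summit).
set_option linter.dupNamespace false

namespace Summit.ValiantsHypothesis.ValiantsHypothesis.Theorems

namespace CorePatterns

open MvPolynomial Finset Equiv
open Literature.Computability.AlgebraicComplexity (homPoly)
open Literature.Combinatorics.SimpleGraph (treewidth)

/-- **Exactly permuted families of placed polynomial local forms have narrow products.**  If every `Lf i` is a
polynomial in the local atoms of a core `Fin r × Fin c` (`r + c ≤ w`) placed injectively, and every row/column
renaming permutes the family exactly, then `Π_i Lf_i ∈ span_ℂ {hom_{F,n} : tw F ≤ w}`.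
[folklore; cite: DwivediPagoSeppelt2026, §8] -/
theorem prod_mem_narrowSpan_of_stable_localPolyFactors (n w : ℕ) {ι : Type} [Fintype ι]
    (Lf : ι → MvPolynomial (Fin n × Fin n) ℂ)
    (hstab : ∀ σ τ : Perm (Fin n), ∃ κ : Perm ι, ∀ i,
      rename (fun P : Fin n × Fin n => (σ P.1, τ P.2)) (Lf i) = Lf (κ i))
    (hloc : ∀ i, ∃ (r c : ℕ) (eR : Fin r → Fin n) (eC : Fin c → Fin n)
      (P : MvPolynomial ((Fin r × Fin c) ⊕ (Fin r ⊕ Fin c)) ℂ), r + c ≤ w ∧ Function.Injective eR ∧ Function.Injective eC ∧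
      Lf i = aeval (Sum.elim (fun ab : Fin r × Fin c => (X (eR ab.1, eC ab.2) : MvPolynomial (Fin n × Fin n) ℂ))
        (Sum.elim (fun a : Fin r => ∑ j : Fin n, (X (eR a, j) : MvPolynomial (Fin n × Fin n) ℂ))
          (fun b : Fin c => ∑ j : Fin n, (X (j, eC b) : MvPolynomial (Fin n × Fin n) ℂ)))) P) :
    (∏ i, Lf i) ∈ Submodule.span ℂ {p : MvPolynomial (Fin n × Fin n) ℂ |
        ∃ (a b : ℕ) (E : Multiset (Fin a × Fin b)),
          treewidth (SimpleGraph.fromRel fun u v : Fin a ⊕ Fin b =>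
            ∃ e ∈ E, u = Sum.inl e.1 ∧ v = Sum.inr e.2) ≤ w ∧ p = homPoly E n ℂ} := by
  classical
  refine NarrowSpanNewton.prod_mem_narrowSpan_of_psum_mem n w Lf fun m => ?_
  -- |G| • P_m = Σ_i Σ_{σ,τ} ((σ,τ)·Lf_i)^m
  have hG : ∀ σ τ : Perm (Fin n), (∑ i, (rename (fun P : Fin n × Fin n => (σ P.1, τ P.2)) (Lf i)) ^ m) =
      ∑ i, Lf i ^ m := by
    intro σ τ
    obtain ⟨κ, hκ⟩ := hstab σ τ
    simp_rw [hκ]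
    exact Equiv.sum_comp κ (fun i => Lf i ^ m)
  have hsum : (∑ i, ∑ σ : Perm (Fin n), ∑ τ : Perm (Fin n),
        (rename (fun P : Fin n × Fin n => (σ P.1, τ P.2)) (Lf i)) ^ m) =
      (Fintype.card (Perm (Fin n)) * Fintype.card (Perm (Fin n))) • ∑ i, Lf i ^ m := by
    rw [Finset.sum_comm]
    have h2 : ∀ σ : Perm (Fin n), (∑ i, ∑ τ : Perm (Fin n),
        (rename (fun P : Fin n × Fin n => (σ P.1, τ P.2)) (Lf i)) ^ m) =
        Fintype.card (Perm (Fin n)) • ∑ i, Lf i ^ m := by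
      intro σ
      rw [Finset.sum_comm]
      simp_rw [hG]
      rw [Finset.sum_const, Finset.card_univ]
    simp_rw [h2]
    rw [Finset.sum_const, Finset.card_univ, smul_smul]
  -- each inner double average is a multiple of an injective-placement sum of `P_i ^ m`
  have hmem : (∑ i, ∑ σ : Perm (Fin n), ∑ τ : Perm (Fin n),
        (rename (fun P : Fin n × Fin n => (σ P.1, τ P.2)) (Lf i)) ^ m) ∈
      Submodule.span ℂ {p : MvPolynomial (Fin n × Fin n) ℂ |
        ∃ (a b : ℕ) (E : Multiset (Fin a × Fin b)),
          treewidth (SimpleGraph.fromRel fun u v : Fin a ⊕ Fin b =>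
            ∃ e ∈ E, u = Sum.inl e.1 ∧ v = Sum.inr e.2) ≤ w ∧ p = homPoly E n ℂ} := by
    refine Submodule.sum_mem _ fun i _ => ?_
    obtain ⟨r, c, eR, eC, P, hw, heR, heC, hLi⟩ := hloc i
    obtain ⟨N₁, -, hN₁⟩ := exists_sum_perm_comp_eq eR heR
    obtain ⟨N₂, -, hN₂⟩ := exists_sum_perm_comp_eq eC heC
    rw [hLi]
    simp only [rename_rowCol_aeval_atoms, ← map_pow]
    have h1 := hN₁ (fun φ => ∑ τ : Perm (Fin n),
      aeval (Sum.elim (fun ab : Fin r × Fin c => (X (φ ab.1, (⇑τ ∘ eC) ab.2) : MvPolynomial (Fin n × Fin n) ℂ))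
        (Sum.elim (fun a : Fin r => ∑ j : Fin n, (X (φ a, j) : MvPolynomial (Fin n × Fin n) ℂ))
          (fun b : Fin c => ∑ j : Fin n, (X (j, (⇑τ ∘ eC) b) : MvPolynomial (Fin n × Fin n) ℂ)))) (P ^ m))
    rw [h1]
    have h2 : ∀ φ : Fin r → Fin n, (∑ τ : Perm (Fin n),
      aeval (Sum.elim (fun ab : Fin r × Fin c => (X (φ ab.1, (⇑τ ∘ eC) ab.2) : MvPolynomial (Fin n × Fin n) ℂ))
        (Sum.elim (fun a : Fin r => ∑ j : Fin n, (X (φ a, j) : MvPolynomial (Fin n × Fin n) ℂ))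
          (fun b : Fin c => ∑ j : Fin n, (X (j, (⇑τ ∘ eC) b) : MvPolynomial (Fin n × Fin n) ℂ)))) (P ^ m)) =
      N₂ • ∑ ψ ∈ (univ : Finset (Fin c → Fin n)).filter (fun ψ => Function.Injective ψ),
        aeval (Sum.elim (fun ab : Fin r × Fin c => (X (φ ab.1, ψ ab.2) : MvPolynomial (Fin n × Fin n) ℂ))
          (Sum.elim (fun a : Fin r => ∑ j : Fin n, (X (φ a, j) : MvPolynomial (Fin n × Fin n) ℂ))
            (fun b : Fin c => ∑ j : Fin n, (X (j, ψ b) : MvPolynomial (Fin n × Fin n) ℂ)))) (P ^ m) := by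
      intro φ
      exact hN₂ (fun ψ =>
        aeval (Sum.elim (fun ab : Fin r × Fin c => (X (φ ab.1, ψ ab.2) : MvPolynomial (Fin n × Fin n) ℂ))
          (Sum.elim (fun a : Fin r => ∑ j : Fin n, (X (φ a, j) : MvPolynomial (Fin n × Fin n) ℂ))
            (fun b : Fin c => ∑ j : Fin n, (X (j, ψ b) : MvPolynomial (Fin n × Fin n) ℂ)))) (P ^ m))
    simp_rw [h2]
    simp_rw [← Finset.smul_sum]
    refine nsmul_mem (nsmul_mem ?_ _) _
    refine (Submodule.span_mono ?_) (sum_injective_injective_aeval_mem_narrowSpan n r c (P ^ m))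
    rintro p ⟨a, b, E, hE, rfl⟩
    exact ⟨a, b, E, hE.trans hw, rfl⟩
  -- divide by |G|
  have hcard : ((Fintype.card (Perm (Fin n)) * Fintype.card (Perm (Fin n)) : ℕ) : ℂ) ≠ 0 := by
    have : 0 < Fintype.card (Perm (Fin n)) := Fintype.card_pos
    exact_mod_cast (Nat.mul_pos this this).ne'
  have : (∑ i, Lf i ^ m) = ((Fintype.card (Perm (Fin n)) * Fintype.card (Perm (Fin n)) : ℕ) : ℂ)⁻¹ •
      ((Fintype.card (Perm (Fin n)) * Fintype.card (Perm (Fin n))) • ∑ i, Lf i ^ m) := by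
    rw [← Nat.cast_smul_eq_nsmul ℂ, inv_smul_smul₀ hcard]
  rw [this, ← hsum]
  exact Submodule.smul_mem _ _ hmem

end CorePatterns

end Summit.ValiantsHypothesis.ValiantsHypothesis.Theorems

end
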